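import Mathlib
import HarnessLib
import Summits.BirchSwinnertonDyer.BirchSwinnertonDyer.Theses.ManinLocalTwoThree
import Summits.BirchSwinnertonDyer.BirchSwinnertonDyer.Theorems.ManinLocalTwoThreeOddUntwistReductions

/-!
# Lines/dyadic-twist v3 (RESHAPE CANDIDATE, seat bsd-line-manin23-p2) — crux `ManinOddAtFour` (C2, stmt-22967)

State after the landings of 2026-08-27T23:xxZ: of the registered line `dyadic-twist` v2
(stubs `stub_etaTwo` ✓ p582690 (p3), `stub_dyadicTwistConductor` ✓ p582649 (p2), `stub_twistMinimalAtTwo` open)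
the only open stub is the twist-minimal core, and the landed reduction
`Theorems.maninLocalTwoThree_twistMinimalAtTwo_of_oddUntwistMinimal` (p584087) shrinks it to the classes with
NO odd semistable untwist. This candidate re-cuts the line to ONE stub = that smaller core, with the
composition through the landed theorems (`maninLocalTwoThree_maninOddAtFour_of_oddUntwistMinimal`, p584608):

* `stub_oddUntwistMinimalAtTwo` — Manin's conjecture at `2` (mod the four printed facts) for the optimal
  curves with `4 ∣ N` whose class is (i) NOT a `χ₋₄/χ₈/χ₋₈`-twist of a class semistable at `2` and
  (ii) NOT a `χ_{q*}`-twist (`q` odd prime, `q² ∣ N`) of a class semistable at `q` — the «globally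
  twist-minimal» additive-at-`2` classes (potentially good at `2`, `e₂ ∈ {3,4,6,8,24}`, and no odd prime of
  Kodaira type `I₀*`/`Iₙ*` for `q ≥ 5`). OPEN; no printed theorem; infinite locus.
Not registered by this seat (p1 holds STUB 3 of v2); offered to the planner-of-record / p1.
-/

set_option autoImplicit false
set_option linter.dupNamespace false

noncomputable section

open WeierstrassCurve Literature.NumberTheory.EllipticCurves
  Literature.NumberTheory.EllipticCurves.ModularForms

namespace Summit.BirchSwinnertonDyer.BirchSwinnertonDyer.Cruxes.ManinOddAtFour.DyadicTwistV3

/-- STUB (GLOBALLY-TWIST-MINIMAL CORE AT `2`; size XL; open). -/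
theorem stub_oddUntwistMinimalAtTwo :
    Literature.NumberTheory.EllipticCurves.ModularForms.mazur_not_dvd_maninConstant_of_odd →
    Literature.NumberTheory.EllipticCurves.ModularForms.abbesUllmo_not_dvd_maninConstant_of_not_dvd_level →
    Literature.NumberTheory.EllipticCurves.ModularForms.cesnavicius_not_two_dvd_maninConstant_of_two_dvd_level →
    Literature.NumberTheory.EllipticCurves.ModularForms.exists_isNewformOf →
    ∀ (W : WeierstrassCurve ℚ) [W.IsElliptic] [W.IsGloballyMinimal] {N : ℕ} [NeZero N]
      (D : ModularParametrizationData W N),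
      (∀ z ∈ D.L.lattice, ∃ w ∈ periodLattice D.f, z = D.c * w) → 2 ^ 2 ∣ N →
      ¬ (∃ (W' : WeierstrassCurve ℚ) (d : ℤ), W'.IsElliptic ∧ W'.IsGloballyMinimal ∧
        (d = -1 ∨ d = 2 ∨ d = -2) ∧ IsIsogenous W (W'.quadraticTwist (d : ℚ)) ∧
        ¬ 2 ^ 2 ∣ W'.conductorNorm ℤ) →
      ¬ (∃ (W' : WeierstrassCurve ℚ) (q : ℕ), W'.IsElliptic ∧ W'.IsGloballyMinimal ∧
        q.Prime ∧ q ≠ 2 ∧ q ^ 2 ∣ N ∧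
        IsIsogenous W (W'.quadraticTwist (((-1 : ℤ) ^ (q / 2) * q : ℤ) : ℚ)) ∧
        ¬ q ^ 2 ∣ W'.conductorNorm ℤ) →
      ¬ (2 : ℤ) ∣ D.maninConstant := by
  sorry

/-- COMPOSITION (no sorry): the single stub gives the crux BY NAME, through the landed theorems
(twist-covered half: `stub_etaTwo` + `stub_dyadicTwistConductor` + tree `η = 1`; odd-untwisting reduction). -/
theorem ManinOddAtFour_of :
    Summit.BirchSwinnertonDyer.BirchSwinnertonDyer.Theses.ManinLocalTwoThree.ManinOddAtFour :=
  Summit.BirchSwinnertonDyer.BirchSwinnertonDyer.Theorems.maninLocalTwoThree_maninOddAtFour_of_oddUntwistMinimal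
    stub_oddUntwistMinimalAtTwo

end Summit.BirchSwinnertonDyer.BirchSwinnertonDyer.Cruxes.ManinOddAtFour.DyadicTwistV3

end
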